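import Summits.HubbardSuperconductivity.HubbardSuperconductivity.Theorems.AposterioriCapRgSsbToEvenTorusLroPairTransferRung
import Literature.MathematicalPhysics.QuantumLattice.FinDimSpectrumSectorGibbsLimit
import Literature.MathematicalPhysics.QuantumLattice.FinDimSpectrumClusterGapProofs
import Literature.MathematicalPhysics.QuantumLattice.FreeFermiGasNoPairFieldLRO
import Literature.MathematicalPhysics.QuantumLattice.SectorEigenvalueContinuation

/-!
# Route `JosephsonMirror` — the bridge engine: ground-floor pair order ⇒ adjacent-floor pair bridge

Helper file for the crux stmt-HubbardSuperconductivity-2227 (`JmInterchange`) of route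
`JosephsonMirror` (sub-problem `HubbardSuperconductivity`), line `Sketch`, stub
`stub_bridgeFromFloorOrder`: the theorem `bridgeFromFloorOrder` is the def body of the skeleton's
`BridgeFromFloorOrder` with `LowLyingOrthogonality`, `ChargingFloor`, `FloorOrder`, `FloorBridge`
and `statN` unfolded.

Setting: `H = hubbardTorus 2 L 1 U`, `Δ = pairField dWaveFormFactor L` (the `d`-wave pair field),
`N_L = 2⌊(1-δ)L²/2⌋`, `e(k) = minEnergyOn H (szSector k 0)`, and a scale `γ_L` with `γ_L L² → ∞`.
Hypotheses (the two model inputs and the floor order): (i) low-lying orthogonality — every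
eigenvector of `H` in the sector `(N_L - 2, S^z = 0)` with eigenvalue in the open window
`(e(N_L-2), e(N_L-2) + γ_L)` is orthogonal to `Δ g` for every sector-`(N_L, 0)` ground state `g`;
(ii) charging floor — `2e(N_L) - e(N_L+2) - e(N_L-2) ≤ ε γ_L` eventually, for every `ε > 0`;
(iii) floor order — eventually some unit ground state `g` of `(N_L, 0)` has `‖Δ g‖² ≥ cL⁴`.
Conclusion (the crux's `FloorBridge`): eventually a unit ground state `χ` of `(N_L - 2, 0)` has
`|⟨χ, Δ g⟩|² ≥ (c/2) L⁴`.

Proof. (1) The tree's two-sided pair-transfer rung `Theorems.stub_pairTransferRung` (at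
`m = N_L - 2`, `a = δ/2`) bounds the excitation energy of `u = Δ g` in its sector
`K = szSector (N_L-2) 0`:
`exc := Re⟨u, Hu⟩ - e(N_L-2)‖u‖² ≤ CL² + max(0, 2e(N_L) - e(N_L-2) - e(N_L+2)) ‖u‖²` (the `N_L + 2`
summand of the rung is nonnegative by the sector variational principle); by (ii) at `ε = 1/4` this
is `≤ CL² + (γ_L/4)‖u‖²`. (2) Spectral Markov in the invariant sector `K`
(`spectralMarkov_of_window_orthogonal`): with `u₀ = P_{E₀} u` the orthogonal projection onto the
sector ground eigenspace `E₀ = K ⊓ ker(H - e)`, the remainder `r = u - u₀ ∈ K` is orthogonal to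
every eigenvector of `H|K` with eigenvalue `< e + γ_L` (below `e`: none; at `e`: `r ⊥ E₀`; in the
window: hypothesis (i) and orthogonality of eigenvectors), hence `Re⟨r, Hr⟩ ≥ (e + γ_L)‖r‖²`
(`le_rayleigh_of_orthogonal_eigenvectors_below`, eigenbasis expansion), and so
`γ_L (‖u‖² - ‖u₀‖²) ≤ exc`. (3) For `γ_L L² ≥ 4C/c`: `‖u₀‖² ≥ (3/4)‖u‖² - CL²/γ_L ≥ (c/2)L⁴ > 0`,
and `χ = u₀/‖u₀‖` is a sector ground state with `|⟨χ, Δ g⟩|² = ‖u₀‖²`.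

Sources: T. Koma, H. Tasaki, J. Stat. Phys. 76 (1994) 745 (pair-transfer / LRO ⇒ SSB mechanism);
H. Tasaki, *Physics and Mathematics of Quantum Many-Body Systems* (2020) §2.1, App. A.2
(variational principle, spectral projections); C. Eckart, Phys. Rev. 36 (1930) 878 (Markov capture
of a trial vector by the ground floor). All linear algebra is folklore. No new definitions.
-/

-- the mandated namespace `Summit.<Summit>.<Problem>.Theorems` repeats `HubbardSuperconductivity`
-- (single-problem summit, D-0017), which the `dupNamespace` linter flags on every declaration
set_option linter.dupNamespace false

namespace Summit.HubbardSuperconductivity.HubbardSuperconductivity.Theorems.JosephsonMirror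

open Matrix Literature.MathematicalPhysics.QuantumLattice Filter
open Literature.MathematicalPhysics.QuantumLattice.EigenvalueContinuation
open scoped ComplexOrder InnerProductSpace

/-! ## §1 Spectral Markov on an invariant sector -/

section Spectral

variable {n : Type*} [Fintype n] [DecidableEq n]

/-- **Rayleigh lower bound from orthogonality to the low eigenvectors of an invariant sector.**
`H` Hermitian, `K` an `H`-invariant subspace, `r ∈ K`; if `⟨w, r⟩ = 0` for every eigenvector
`w ∈ K` of `H` with eigenvalue `< t`, then `t ‖r‖² ≤ Re⟨r, H r⟩`. (Expand in an orthonormal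
eigenbasis `bⱼ` of `H` on the whole space: `⟨bⱼ, r⟩ = ⟨P_K bⱼ, r⟩` since `P_K r = r`, and
`P_K bⱼ ∈ K` is a `λⱼ`-eigenvector because `P_K` commutes with `H`; so the coefficients with
`λⱼ < t` vanish and `Re⟨r, Hr⟩ = Σ λⱼ |⟨bⱼ, r⟩|² ≥ t Σ |⟨bⱼ, r⟩|² = t‖r‖²`.)
Tasaki (2020) App. A.2. [folklore] -/
theorem le_rayleigh_of_orthogonal_eigenvectors_below {H : Matrix n n ℂ} (hH : H.IsHermitian)
    (K : Submodule ℂ (n → ℂ)) (hinv : ∀ v ∈ K, H *ᵥ v ∈ K) {r : n → ℂ} (hr : r ∈ K) (t : ℝ)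
    (horth : ∀ w ∈ K, ∀ μ : ℝ, H *ᵥ w = (μ : ℂ) • w → μ < t → star w ⬝ᵥ r = 0) :
    t * (star r ⬝ᵥ r).re ≤ (star r ⬝ᵥ H *ᵥ r).re := by
  set P := projMatrix (K.map ((WithLp.linearEquiv 2 ℂ (n → ℂ)).symm :
    (n → ℂ) →ₗ[ℂ] EuclideanSpace ℂ n)) with hP
  -- the eigenbasis
  have hcol : ∀ j, H *ᵥ ⇑(hH.eigenvectorBasis j) =
      ((hH.eigenvalues j : ℝ) : ℂ) • ⇑(hH.eigenvectorBasis j) := by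
    intro j
    rw [hH.mulVec_eigenvectorBasis j, RCLike.real_smul_eq_coe_smul (K := ℂ)]
    rfl
  -- the coefficients of `r` along eigenvectors below `t` vanish
  have hcoef : ∀ j, hH.eigenvalues j < t →
      ⟪hH.eigenvectorBasis j, (WithLp.toLp 2 r : EuclideanSpace ℂ n)⟫_ℂ = 0 := by
    intro j hj
    have hw : H *ᵥ (P *ᵥ ⇑(hH.eigenvectorBasis j)) =
        ((hH.eigenvalues j : ℝ) : ℂ) • (P *ᵥ ⇑(hH.eigenvectorBasis j)) := by
      rw [mulVec_mulVec, hP, ← projMatrix_map_commute_of_invariant hH K hinv, ← mulVec_mulVec,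
        hcol j, mulVec_smul]
    have h0 := horth _ (projMatrix_map_mulVec_mem K _) _ hw hj
    rw [star_mulVec, ← dotProduct_mulVec, (projMatrix_isHermitian _).eq,
      projMatrix_map_mulVec_of_mem K hr] at h0
    rw [EuclideanSpace.inner_eq_star_dotProduct, dotProduct_comm]
    exact h0
  have hquad : (star r ⬝ᵥ H *ᵥ r).re = ∑ i, hH.eigenvalues i *
      ‖⟪hH.eigenvectorBasis i, (WithLp.toLp 2 r : EuclideanSpace ℂ n)⟫_ℂ‖ ^ 2 := by
    rw [← re_inner_toEuclideanLin_eq_sum hH, RCLike.re_to_complex,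
      EuclideanSpace.inner_eq_star_dotProduct]
    exact congrArg Complex.re (dotProduct_comm _ _)
  have hnorm : (star r ⬝ᵥ r).re =
      ∑ i, ‖⟪hH.eigenvectorBasis i, (WithLp.toLp 2 r : EuclideanSpace ℂ n)⟫_ℂ‖ ^ 2 := by
    rw [Matrix.star_dotProduct_self_re, norm_sq_eq_sum_eigenvectorBasis hH]
  rw [hquad, hnorm, Finset.mul_sum]
  refine Finset.sum_le_sum fun i _ => ?_
  by_cases hi : hH.eigenvalues i < t
  · rw [hcoef i hi, norm_zero]
    simp
  · exact mul_le_mul_of_nonneg_right (not_lt.1 hi) (sq_nonneg _)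

/-- The sector variational principle without normalisation: `minEnergyOn H K · ‖v‖² ≤ Re⟨v, Hv⟩`
for every `v ∈ K` (`minEnergyOn_le_rayleigh_of_mem` after normalising; trivial at `v = 0`).
Tasaki (2020) §2.1. [folklore] -/
theorem minEnergyOn_mul_le_of_mem {H : Matrix n n ℂ} (hH : H.IsHermitian)
    (K : Submodule ℂ (n → ℂ)) {v : n → ℂ} (hv : v ∈ K) :
    H.minEnergyOn K * (star v ⬝ᵥ v).re ≤ (star v ⬝ᵥ H *ᵥ v).re := by
  by_cases hv0 : v = 0
  · simp [hv0]
  obtain ⟨c, -, hcc, h1⟩ := exists_normalize hv0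
  have hle := minEnergyOn_le_rayleigh_of_mem hH K (K.smul_mem (c : ℂ) hv) h1
  rw [mulVec_smul, star_real_smul_dotProduct_real_smul, Complex.re_ofReal_mul] at hle
  calc H.minEnergyOn K * (star v ⬝ᵥ v).re
      ≤ c * c * (star v ⬝ᵥ H *ᵥ v).re * (star v ⬝ᵥ v).re :=
        mul_le_mul_of_nonneg_right hle (re_star_dotProduct_self_nonneg v)
    _ = (star v ⬝ᵥ H *ᵥ v).re * (c * c * (star v ⬝ᵥ v).re) := by ring
    _ = (star v ⬝ᵥ H *ᵥ v).re := by rw [hcc, mul_one]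

/-- **Spectral Markov on an invariant sector, with a window orthogonality hypothesis.**
`H` Hermitian, `K` an `H`-invariant subspace with sector energy `e = minEnergyOn H K`, `u ∈ K`;
suppose every eigenvector `w ∈ K` of `H` with eigenvalue in the open window `(e, e + γ)` is
orthogonal to `u`. Let `u₀ = P_{E₀} u` be the orthogonal projection of `u` onto the sector ground
eigenspace `E₀ = K ⊓ ker (H - e)`. Then `u₀ ∈ K`, `H u₀ = e u₀`, `⟨u₀, u⟩ = ‖u₀‖²`, and
`γ (‖u‖² - ‖u₀‖²) ≤ Re⟨u, Hu⟩ - e‖u‖²`: the remainder `r = u - u₀ ∈ K` is orthogonal to every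
eigenvector of `H|K` below `e + γ` (there is none below `e`; at `e` use `r ⊥ E₀`; in the window use
the hypothesis and the orthogonality of eigenvectors to distinct eigenvalues), so
`Re⟨r, Hr⟩ ≥ (e + γ)‖r‖²`, while `‖u‖² = ‖u₀‖² + ‖r‖²` and `Re⟨u, Hu⟩ = e‖u₀‖² + Re⟨r, Hr⟩`.
Tasaki (2020) §2.1, App. A.2; Eckart, Phys. Rev. 36 (1930) 878. [folklore] -/
theorem spectralMarkov_of_window_orthogonal {H : Matrix n n ℂ} (hH : H.IsHermitian)
    (K : Submodule ℂ (n → ℂ)) (hinv : ∀ v ∈ K, H *ᵥ v ∈ K) {u : n → ℂ} (hu : u ∈ K) (γ : ℝ)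
    (horth : ∀ (w : n → ℂ) (E : ℝ), w ∈ K → H *ᵥ w = (E : ℂ) • w → H.minEnergyOn K < E →
      E < H.minEnergyOn K + γ → star w ⬝ᵥ u = 0) :
    ∃ u₀ : n → ℂ, u₀ ∈ K ∧ H *ᵥ u₀ = ((H.minEnergyOn K : ℝ) : ℂ) • u₀ ∧
      star u₀ ⬝ᵥ u = star u₀ ⬝ᵥ u₀ ∧
      γ * ((star u ⬝ᵥ u).re - (star u₀ ⬝ᵥ u₀).re) ≤
        (star u ⬝ᵥ H *ᵥ u).re - H.minEnergyOn K * (star u ⬝ᵥ u).re := by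
  set e : ℝ := H.minEnergyOn K with he
  set E₀ : Submodule ℂ (n → ℂ) := K ⊓ Module.End.eigenspace (Matrix.toLin' H) ((e : ℝ) : ℂ)
    with hE₀
  have hmemE₀ : ∀ w, w ∈ E₀ ↔ w ∈ K ∧ H *ᵥ w = ((e : ℝ) : ℂ) • w := fun w => by
    rw [hE₀, Submodule.mem_inf, Module.End.mem_eigenspace_iff, Matrix.toLin'_apply]
  set P₀ := projMatrix (E₀.map ((WithLp.linearEquiv 2 ℂ (n → ℂ)).symm :
    (n → ℂ) →ₗ[ℂ] EuclideanSpace ℂ n)) with hP₀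
  have hP₀h : P₀.IsHermitian := projMatrix_isHermitian _
  set u₀ : n → ℂ := P₀ *ᵥ u with hu₀
  have hu₀E : u₀ ∈ E₀ := projMatrix_map_mulVec_mem E₀ u
  obtain ⟨hu₀K, hHu₀⟩ := (hmemE₀ u₀).1 hu₀E
  -- `⟨χ, u₀⟩ = ⟨χ, u⟩` for `χ ∈ E₀`, i.e. `r = u - u₀ ⊥ E₀`
  have hproj : ∀ χ ∈ E₀, star χ ⬝ᵥ u₀ = star χ ⬝ᵥ u := by
    intro χ hχ
    have hPχ : P₀ *ᵥ χ = χ := by rw [hP₀]; exact projMatrix_map_mulVec_of_mem E₀ hχ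
    calc star χ ⬝ᵥ u₀ = star (P₀ *ᵥ χ) ⬝ᵥ u := by
          rw [hu₀, star_mulVec, ← dotProduct_mulVec, hP₀h.eq]
      _ = star χ ⬝ᵥ u := by rw [hPχ]
  set r : n → ℂ := u - u₀ with hr
  have hrK : r ∈ K := K.sub_mem hu hu₀K
  have horthE₀ : ∀ χ ∈ E₀, star χ ⬝ᵥ r = 0 := fun χ hχ => by
    rw [hr, dotProduct_sub, hproj χ hχ, sub_self]
  -- `r` is orthogonal to every eigenvector of `H|K` below `e + γ`
  have hlow : ∀ w ∈ K, ∀ μ : ℝ, H *ᵥ w = (μ : ℂ) • w → μ < e + γ → star w ⬝ᵥ r = 0 := by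
    intro w hwK μ hHw hμ
    rcases lt_trichotomy μ e with hlt | heq | hgt
    · -- below the sector floor: `w = 0`
      have h0 : w = 0 := by
        rw [← projMatrix_map_mulVec_of_mem K hwK]
        exact projMatrix_map_mulVec_eigenvector_below_eq_zero hH K hinv hHw hlt
      rw [h0, star_zero, zero_dotProduct]
    · -- on the floor: `w ∈ E₀ ⊥ r`
      refine horthE₀ w ((hmemE₀ w).2 ⟨hwK, ?_⟩)
      rw [← heq]
      exact hHw
    · -- in the window: `w ⊥ u` (hypothesis) and `w ⊥ u₀` (distinct eigenvalues)
      have h1 : star w ⬝ᵥ u = 0 := horth w μ hwK hHw hgt hμ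
      have h2 : star w ⬝ᵥ u₀ = 0 :=
        star_dotProduct_eigenvectors_eq_zero_of_ne hH hHu₀ hHw hgt.ne'
      rw [hr, dotProduct_sub, h1, h2, sub_self]
  have hgap : (e + γ) * (star r ⬝ᵥ r).re ≤ (star r ⬝ᵥ H *ᵥ r).re :=
    le_rayleigh_of_orthogonal_eigenvectors_below hH K hinv hrK (e + γ) hlow
  -- Pythagoras and the energy split
  have hu₀r : star u₀ ⬝ᵥ r = 0 := horthE₀ u₀ hu₀E
  have hru₀ : star r ⬝ᵥ u₀ = 0 := by rw [star_dotProduct, hu₀r, star_zero]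
  have hur : u = u₀ + r := by rw [hr, add_sub_cancel]
  have hnorm : (star u ⬝ᵥ u).re = (star u₀ ⬝ᵥ u₀).re + (star r ⬝ᵥ r).re := by
    rw [hur, star_add, add_dotProduct, dotProduct_add, dotProduct_add, hu₀r, hru₀, add_zero,
      zero_add, Complex.add_re]
  have henergy : (star u ⬝ᵥ H *ᵥ u).re = e * (star u₀ ⬝ᵥ u₀).re + (star r ⬝ᵥ H *ᵥ r).re := by
    have h1 : star r ⬝ᵥ H *ᵥ u₀ = 0 := by rw [hHu₀, dotProduct_smul, hru₀, smul_zero]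
    have h2 : star u₀ ⬝ᵥ H *ᵥ r = 0 := by rw [star_dotProduct_mulVec_comm hH.eq, h1, star_zero]
    rw [hur, mulVec_add, star_add, add_dotProduct, dotProduct_add, dotProduct_add, h1, h2,
      add_zero, zero_add, Complex.add_re, re_star_dotProduct_mulVec_of_eigen hHu₀]
  refine ⟨u₀, hu₀K, hHu₀, ?_, ?_⟩
  · rw [hur, dotProduct_add, hu₀r, add_zero]
  · rw [hnorm, henergy]
    linarith [hgap]

end Spectral

/-! ## §2 The bridge engine on the torus -/

/-- The real-arithmetic endgame of the bridge: from the Markov capture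
`γ (S - X) ≤ A - e S`, the rung `(A - e S) + (A' - e' S') ≤ C L² + M S` with `e' S' ≤ A'` and
`M S ≤ (γ/4) S`, the floor order `c L⁴ ≤ S` and the scale condition `4 C ≤ γ L² c` (`γ > 0`):
`(c/2) L⁴ ≤ X`. [folklore] -/
theorem bridge_real_endgame {γ S X A e A' e' S' C M c L2 : ℝ} (hγ : 0 < γ) (hL2 : 0 ≤ L2)
    (hmk : γ * (S - X) ≤ A - e * S)
    (h3 : A - e * S + (A' - e' * S') ≤ C * L2 + M * S) (hvar : e' * S' ≤ A')
    (hM : M * S ≤ γ / 4 * S) (hS : c * L2 ^ 2 ≤ S) (hG : 4 * C ≤ γ * L2 * c) :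
    c / 2 * L2 ^ 2 ≤ X := by
  have h1 : γ * (c * L2 ^ 2) ≤ γ * S := mul_le_mul_of_nonneg_left hS hγ.le
  have h2 : C * L2 ≤ γ * L2 * c / 4 * L2 := mul_le_mul_of_nonneg_right (by linarith) hL2
  have h : γ * (c / 2 * L2 ^ 2) ≤ γ * X := by nlinarith [h1, h2, hmk, h3, hvar, hM]
  exact le_of_mul_le_mul_left h hγ

/-- **The bridge engine** (`BridgeFromFloorOrder` of the skeleton of crux `JmInterchange`, line
`Sketch`, with `LowLyingOrthogonality`, `ChargingFloor`, `FloorOrder`, `FloorBridge`, `statN`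
unfolded). For `H = hubbardTorus 2 L 1 U`, `Δ = pairField dWaveFormFactor L`,
`N_L = 2⌊(1-δ)L²/2⌋`, `e(k) = minEnergyOn H (szSector k 0)` and a scale `γ_L` with `γ_L L² → ∞`:
if (i) the eigenvectors of `H` in `szSector (N_L - 2) 0` with eigenvalue in
`(e(N_L-2), e(N_L-2) + γ_L)` are orthogonal to `Δ g` for every ground state `g` of `(N_L, 0)`,
(ii) `2e(N_L) - e(N_L+2) - e(N_L-2) ≤ ε γ_L` eventually for every `ε > 0`, and (iii) eventually some
unit ground state `g` of `(N_L, 0)` has `‖Δ g‖² ≥ cL⁴`, then eventually there are unit ground states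
`φ` of `(N_L, 0)` and `χ` of `(N_L - 2, 0)` with `|⟨χ, Δ φ⟩|² ≥ (c/2)L⁴`. Two-sided pair-transfer
rung `Theorems.stub_pairTransferRung` + `spectralMarkov_of_window_orthogonal`; see the module
docstring. Koma–Tasaki, J. Stat. Phys. 76 (1994) 745. [folklore] -/
theorem bridgeFromFloorOrder :
    ∀ (U δ : ℝ), 0 < U → δ ∈ Set.Ioo (0:ℝ) (1 / 2) → ∀ γ : ℕ → ℝ,
    Tendsto (fun L : ℕ => γ L * (L : ℝ) ^ 2) atTop atTop →
    (∃ L₀ : ℕ, ∀ (L : ℕ) [NeZero L], Even L → L₀ ≤ L →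
      ∀ g : Fock (Orb (FermionTorus 2 L)),
        IsGroundStateInSector (hubbardTorus 2 L 1 U) (2 * ⌊(1 - δ) * (L : ℝ) ^ 2 / 2⌋₊) 0 g →
        ∀ (w : Fock (Orb (FermionTorus 2 L))) (E : ℝ),
          w ∈ szSector (2 * ⌊(1 - δ) * (L : ℝ) ^ 2 / 2⌋₊ - 2) 0 →
          hubbardTorus 2 L 1 U *ᵥ w = (E : ℂ) • w →
          (hubbardTorus 2 L 1 U).minEnergyOn
              (szSector (2 * ⌊(1 - δ) * (L : ℝ) ^ 2 / 2⌋₊ - 2) 0) < E →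
          E < (hubbardTorus 2 L 1 U).minEnergyOn
              (szSector (2 * ⌊(1 - δ) * (L : ℝ) ^ 2 / 2⌋₊ - 2) 0) + γ L →
            star w ⬝ᵥ (pairField dWaveFormFactor L *ᵥ g) = 0) →
    (∀ ε : ℝ, 0 < ε → ∃ L₀ : ℕ, ∀ (L : ℕ), Even L → L₀ ≤ L →
      (let e : ℕ → ℝ := fun n => (hubbardTorus 2 L 1 U).minEnergyOn (szSector n 0)
       let N : ℕ := 2 * ⌊(1 - δ) * (L : ℝ) ^ 2 / 2⌋₊
       2 * e N - e (N + 2) - e (N - 2) ≤ ε * γ L)) →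
    (∃ c : ℝ, 0 < c ∧ ∃ L₀ : ℕ, ∀ (L : ℕ) [NeZero L], Even L → L₀ ≤ L →
      ∃ g : Fock (Orb (FermionTorus 2 L)),
        IsGroundStateInSector (hubbardTorus 2 L 1 U) (2 * ⌊(1 - δ) * (L : ℝ) ^ 2 / 2⌋₊) 0 g ∧
        star g ⬝ᵥ g = 1 ∧
        c * (L : ℝ) ^ 4 ≤
          (star (pairField dWaveFormFactor L *ᵥ g) ⬝ᵥ (pairField dWaveFormFactor L *ᵥ g)).re) →
    ∃ a' : ℝ, 0 < a' ∧ ∃ L₀ : ℕ, ∀ (L : ℕ) [NeZero L], Even L → L₀ ≤ L → ∃ φ χ : Literature.MathematicalPhysics.QuantumLattice.Fock (Literature.MathematicalPhysics.QuantumLattice.Orb (Literature.MathematicalPhysics.QuantumLattice.FermionTorus 2 L)), Literature.MathematicalPhysics.QuantumLattice.IsGroundStateInSector (Literature.MathematicalPhysics.QuantumLattice.hubbardTorus 2 L 1 U) (2 * ⌊(1 - δ) * (L : ℝ) ^ 2 / 2⌋₊) 0 φ ∧ star φ ⬝ᵥ φ = 1 ∧ Literature.MathematicalPhysics.QuantumLattice.IsGroundStateInSector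 (Literature.MathematicalPhysics.QuantumLattice.hubbardTorus 2 L 1 U) (2 * ⌊(1 - δ) * (L : ℝ) ^ 2 / 2⌋₊ - 2) 0 χ ∧ star χ ⬝ᵥ χ = 1 ∧ a' * (L : ℝ) ^ 4 ≤ ‖star χ ⬝ᵥ Matrix.mulVec (Literature.MathematicalPhysics.QuantumLattice.pairField Literature.MathematicalPhysics.QuantumLattice.dWaveFormFactor L) φ‖ ^ 2 := by
  intro U δ _ hδ γ hγ hLLO hCF hFO
  obtain ⟨L₂, hLLO⟩ := hLLO
  obtain ⟨c, hc, L₁, hFO⟩ := hFO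
  obtain ⟨L₃, hCF⟩ := hCF (1 / 4) (by norm_num)
  obtain ⟨C, hC⟩ :=
    Summit.HubbardSuperconductivity.HubbardSuperconductivity.Theorems.stub_pairTransferRung U
      (δ / 2) (by linarith [hδ.1])
  obtain ⟨L₄, hL₄⟩ := Filter.tendsto_atTop_atTop.1 hγ (max (4 * C / c) 1)
  refine ⟨c / 2, by positivity, max (max L₁ L₂) (max (max L₃ L₄) 4), ?_⟩
  intro L _ hE hL
  simp only [max_le_iff] at hL
  obtain ⟨⟨hL₁, hL₂⟩, ⟨hL₃, hL₄'⟩, h4⟩ := hL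
  -- specialise the three inputs and the scale at the side `L`
  obtain ⟨g, hg, hg1, hgc⟩ := hFO L hE hL₁
  have hD := hCF L hE hL₃
  dsimp only at hD
  have hGL : max (4 * C / c) 1 ≤ γ L * (L : ℝ) ^ 2 := hL₄ L hL₄'
  have hLLOg := hLLO L hE hL₂ g hg
  -- the filling `N_L = 2n`, `n = ⌊(1-δ)L²/2⌋`, and the bulk-window bounds of the rung
  set n : ℕ := ⌊(1 - δ) * (L : ℝ) ^ 2 / 2⌋₊ with hn
  have hL4 : (4 : ℝ) ≤ L := by exact_mod_cast h4
  have hL16 : (16 : ℝ) ≤ (L : ℝ) ^ 2 := by nlinarith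
  have hfl : (1 - δ) * (L : ℝ) ^ 2 / 2 < n + 1 := by rw [hn]; exact Nat.lt_floor_add_one _
  have hfu : (n : ℝ) ≤ (1 - δ) * (L : ℝ) ^ 2 / 2 := by
    rw [hn]
    exact Nat.floor_le (div_nonneg (mul_nonneg (by linarith [hδ.2]) (sq_nonneg _)) (by norm_num))
  have hp1 : 1 / 4 * (L : ℝ) ^ 2 ≤ (1 - 3 * δ / 2) * (L : ℝ) ^ 2 :=
    mul_le_mul_of_nonneg_right (by linarith [hδ.2]) (sq_nonneg _)
  have hp2 : 0 ≤ δ / 2 * (L : ℝ) ^ 2 := mul_nonneg (by linarith [hδ.1]) (sq_nonneg _)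
  have hn1 : 1 ≤ n := by
    have : (1 : ℝ) ≤ n := by linarith
    exact_mod_cast this
  have hN2 : 2 * n - 2 + 2 = 2 * n := by omega
  have hN4 : 2 * n - 2 + 4 = 2 * n + 2 := by omega
  have hcast : ((2 * n - 2 : ℕ) : ℝ) = 2 * (n : ℝ) - 2 := by
    rw [Nat.cast_sub (by omega), Nat.cast_mul]
    norm_num
  have hlow : δ / 2 * (L : ℝ) ^ 2 ≤ ((2 * n - 2 : ℕ) : ℝ) := by rw [hcast]; linarith
  have hup : ((2 * n - 2 : ℕ) : ℝ) + 4 ≤ (2 - δ / 2) * (L : ℝ) ^ 2 := by rw [hcast]; linarith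
  -- the scale: `γ_L > 0` and `4C ≤ γ_L L² c`
  have hγ0 : 0 < γ L := by
    have h1 : (1 : ℝ) ≤ γ L * (L : ℝ) ^ 2 := le_trans (le_max_right _ _) hGL
    by_contra hneg
    have hle : γ L ≤ 0 := not_lt.1 hneg
    nlinarith [sq_nonneg (L : ℝ)]
  have hG : 4 * C ≤ γ L * (L : ℝ) ^ 2 * c := (div_le_iff₀ hc).1 (le_trans (le_max_left _ _) hGL)
  -- the Hamiltonian: Hermitian, conserving `N` and `S^z`, hence leaving the sector invariant
  have hHc := hamiltonian_isHermitian_and_commute_holds (fermionTorusGraph 2 L) 1 U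
  have hHerm : (hubbardTorus 2 L 1 U).IsHermitian := hHc.1
  have hinv : ∀ v ∈ szSector (2 * n - 2) 0,
      hubbardTorus 2 L 1 U *ᵥ v ∈ szSector (2 * n - 2) (0 : ℝ) :=
    fun v hv => mulVec_mem_szSector_of_commute hHc.2.1 hHc.2.2 hv
  -- (1) the rung at `m = N_L - 2`
  have hgN : IsGroundStateInSector (hubbardTorus 2 L 1 U) (2 * n - 2 + 2) 0 g := by
    rw [hN2]; exact hg
  obtain ⟨h1, h2, h3, -, -, -⟩ := hC L (2 * n - 2) g hlow hup hgN hg1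
  rw [hN4] at h2
  rw [hN2, hN4] at h3
  simp only [expect] at h3
  -- Gram identities `⟨g, ΔᴴΔ g⟩ = ‖Δg‖²`, `⟨g, ΔΔᴴ g⟩ = ‖Δᴴg‖²`
  have hSu : star (pairField dWaveFormFactor L *ᵥ g) ⬝ᵥ (pairField dWaveFormFactor L *ᵥ g) =
      star g ⬝ᵥ ((pairField dWaveFormFactor L)ᴴ * pairField dWaveFormFactor L) *ᵥ g :=
    Literature.MathematicalPhysics.QuantumLattice.star_mulVec_dotProduct_mulVec _ _ g
  have hSp : star ((pairField dWaveFormFactor L)ᴴ *ᵥ g) ⬝ᵥ ((pairField dWaveFormFactor L)ᴴ *ᵥ g) =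
      star g ⬝ᵥ (pairField dWaveFormFactor L * (pairField dWaveFormFactor L)ᴴ) *ᵥ g := by
    rw [Literature.MathematicalPhysics.QuantumLattice.star_mulVec_dotProduct_mulVec,
      conjTranspose_conjTranspose]
  rw [← hSu, ← hSp] at h3
  -- the `N_L + 2` summand of the rung is nonnegative (sector variational principle)
  have hvar := minEnergyOn_mul_le_of_mem hHerm (szSector (2 * n + 2) 0) h2
  -- (ii) charging floor at `ε = 1/4`
  have hM : max 0 (2 * (hubbardTorus 2 L 1 U).minEnergyOn (szSector (2 * n) 0) -
        (hubbardTorus 2 L 1 U).minEnergyOn (szSector (2 * n - 2) 0) -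
        (hubbardTorus 2 L 1 U).minEnergyOn (szSector (2 * n + 2) 0)) *
      (star (pairField dWaveFormFactor L *ᵥ g) ⬝ᵥ (pairField dWaveFormFactor L *ᵥ g)).re ≤
      γ L / 4 *
        (star (pairField dWaveFormFactor L *ᵥ g) ⬝ᵥ (pairField dWaveFormFactor L *ᵥ g)).re :=
    mul_le_mul_of_nonneg_right (max_le (by linarith) (by linarith))
      (re_star_dotProduct_self_nonneg _)
  -- (2) spectral Markov in the sector `(N_L - 2, 0)`
  obtain ⟨u₀, hu₀K, hHu₀, hu₀u, hmk⟩ := spectralMarkov_of_window_orthogonal hHerm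
    (szSector (2 * n - 2) 0) hinv h1 (γ L) hLLOg
  -- (3) the endgame: `‖u₀‖² ≥ (c/2) L⁴`
  have hX : c / 2 * ((L : ℝ) ^ 2) ^ 2 ≤ (star u₀ ⬝ᵥ u₀).re :=
    bridge_real_endgame hγ0 (sq_nonneg _) hmk h3 hvar hM (by rw [← pow_mul]; exact hgc) hG
  rw [← pow_mul] at hX
  norm_num at hX
  -- normalise `u₀`
  have hu₀ne : u₀ ≠ 0 := by
    intro h0
    rw [h0, dotProduct_zero, Complex.zero_re] at hX
    have : (0 : ℝ) < c / 2 * (L : ℝ) ^ 4 := by positivity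
    linarith
  obtain ⟨a, -, haa, ha1⟩ := exists_normalize hu₀ne
  have hχne : (a : ℂ) • u₀ ≠ 0 := by
    intro h0
    rw [h0, star_zero, zero_dotProduct] at ha1
    exact zero_ne_one ha1
  have hHχ : hubbardTorus 2 L 1 U *ᵥ ((a : ℂ) • u₀) =
      (((hubbardTorus 2 L 1 U).minEnergyOn (szSector (2 * n - 2) 0) : ℝ) : ℂ) • ((a : ℂ) • u₀) := by
    rw [mulVec_smul, hHu₀, smul_comm]
  have hXc : star u₀ ⬝ᵥ u₀ = (((star u₀ ⬝ᵥ u₀).re : ℝ) : ℂ) :=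
    Complex.ext (by simp) (by simp [im_star_dotProduct_self])
  have hsq : (a * (star u₀ ⬝ᵥ u₀).re) ^ 2 = (star u₀ ⬝ᵥ u₀).re := by
    calc (a * (star u₀ ⬝ᵥ u₀).re) ^ 2 = a * a * (star u₀ ⬝ᵥ u₀).re * (star u₀ ⬝ᵥ u₀).re := by ring
      _ = (star u₀ ⬝ᵥ u₀).re := by rw [haa, one_mul]
  have hbound : c / 2 * (L : ℝ) ^ 4 ≤
      ‖star ((a : ℂ) • u₀) ⬝ᵥ (pairField dWaveFormFactor L *ᵥ g)‖ ^ 2 := by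
    rw [star_smul, smul_dotProduct, hu₀u, hXc, Complex.star_def, Complex.conj_ofReal, smul_eq_mul,
      ← Complex.ofReal_mul, Complex.norm_real, Real.norm_eq_abs, sq_abs, hsq]
    exact hX
  exact ⟨g, (a : ℂ) • u₀, hg, hg1, ⟨Submodule.smul_mem _ _ hu₀K, hχne, hHχ⟩, ha1, hbound⟩

end Summit.HubbardSuperconductivity.HubbardSuperconductivity.Theorems.JosephsonMirror
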